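import Summits.AtomisticToContinuum.FouriersLaw.Theorems.OddSectorIrreversibilityOddDensityIsCorrectorResolvent
import Summits.AtomisticToContinuum.FouriersLaw.Theorems.OddSectorIrreversibilityResponseDensityGibbsTranspose
import Summits.AtomisticToContinuum.FouriersLaw.Theorems.JunctionLocalitySuperadditiveResistanceStubPlainKuboLinkAux1

/-!
# Kernel detailed balance (H2), part A: the Laplace-transformed correlation `B_λ(f,g) = ∫₀^∞ e^{-λt} ⟨f, P_t g⟩_{μ_T} dt`

Support for the registered stub `stub_kernelDetailedBalance` (H2) of crux `stmt-AtomisticToContinuum-9120`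
(`BondHeatUncertainty.SubdiffusiveBondHeat`, line `bath-bond-deficit-integral`). Route: the `L²(μ_T)`-adjoint of
the equilibrium semigroup `P_t` of the pinned anharmonic chain is the momentum-flipped semigroup; this is proved
through the RESOLVENT — `B_λ(f, (λ - L)b) = ⟨f, b⟩_{μ_T}` (Dynkin in resolvent form,
`pinnedChain_resolvent_generator`), the static generalised detailed balance `⟨(L(a∘Θ))∘Θ, b⟩ = ⟨a, L b⟩`
(`langevin_integral_gibbs_mul_generator`) and the density of `(λ - L)C_c^∞` in `L²(μ_T)` (part B / the
registered sub-stub `stub_resolventRangeDense`). This file: the bilinear form `B_λ` on bounded continuous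
observables — measurability, the weighted Cauchy–Schwarz bound `|B_λ(f,g)| ≤ (ε‖f‖² + ε⁻¹‖g‖²)/(2λ)`
(from the `L²(μ_T)`-contraction of `P_t`) and additivity in each slot (the resolvent identity and the flip /
static-adjointness lemmas are in part B). The momentum flip `Θ` and the `Θ`-invariance of `μ_T` are taken from
`…JunctionLocalitySuperadditiveResistanceStubPlainKuboLinkAux1` (`integral_flip_gibbsMeasure`, `contDiff_flip`,
`hasCompactSupport_flip`). Everything is written out (no definitions).
-/

noncomputable section

open MeasureTheory ProbabilityTheory Filter Topology Set Function
open scoped NNReal ENNReal ContDiff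
open Literature.MathematicalPhysics.KineticTheory.HeatConduction
open Literature.MathematicalPhysics.KineticTheory OscillatorChain
open Summit.AtomisticToContinuum.FouriersLaw.Theorems.OddSectorIrreversibility

namespace Summit.AtomisticToContinuum.FouriersLaw.Theorems.SubdiffusiveBondHeat

variable {N : ℕ}

/-! ### Flip bookkeeping -/

/-- `F ∘ Θ` is continuous if `F` is. [folklore] -/
theorem continuous_comp_flip {F : PhaseSpace N → ℝ} (hF : Continuous F) :
    Continuous (fun x : PhaseSpace N => F (x.1, -x.2)) :=
  hF.comp (continuous_fst.prodMk continuous_snd.neg)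

/-- `Θ ∘ Θ = id` on observables. [folklore] -/
theorem comp_flip_flip (F : PhaseSpace N → ℝ) :
    (fun x : PhaseSpace N => (fun y : PhaseSpace N => F (y.1, -y.2)) (x.1, -x.2)) = F := by
  funext x; simp

section Pinned

variable {ω₂ lam β γ : ℝ} (hω : 0 < ω₂) (hl : 0 ≤ lam) (hβ : 0 < β) (hγ : 0 < γ) (hN : 0 < N)
  {T : ℝ} (hT : 0 < T)
include hω hl hβ hγ hN hT

/-! ### The `L²(μ_T)` bound on correlations `⟨f, P_u g⟩` -/

/-- For bounded continuous `g`: `(P_u g)² ∈ L¹(μ_T)` and `∫ (P_u g)² dμ_T ≤ ∫ g² dμ_T` (the `L²(μ_T)`-contraction of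
`P_u`, `pinnedChain_integral_sq_act_le`, specialised to bounded observables). [folklore] -/
theorem pinnedChain_sq_act_le_of_bounded {g : PhaseSpace N → ℝ} (hg : Continuous g) {B : ℝ}
    (hB : ∀ y, ‖g y‖ ≤ B) (u : ℝ≥0) :
    Integrable (fun y => g y ^ 2) ((pinnedChain ω₂ lam β γ).gibbsMeasure N T) ∧
    Integrable (fun z => (∫ y, g y ∂((pinnedChain ω₂ lam β γ).transitionKernel N T T u z)) ^ 2)
      ((pinnedChain ω₂ lam β γ).gibbsMeasure N T) ∧
    ∫ z, (∫ y, g y ∂((pinnedChain ω₂ lam β γ).transitionKernel N T T u z)) ^ 2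
        ∂((pinnedChain ω₂ lam β γ).gibbsMeasure N T) ≤
      ∫ z, g z ^ 2 ∂((pinnedChain ω₂ lam β γ).gibbsMeasure N T) := by
  set ϑ : ℝ := 1 / (4 * T) with hϑ
  have hϑ0 : 0 < ϑ := by positivity
  have h2ϑ : 2 * ϑ < 1 / T := by
    rw [hϑ, show 2 * (1 / (4 * T)) = 1 / (2 * T) by field_simp; ring, div_lt_div_iff₀ (by positivity) hT]
    nlinarith
  have hB0 : 0 ≤ B := (norm_nonneg _).trans (hB 0)
  have hgb : ∀ y, |g y| ≤ B * Real.exp (ϑ * (pinnedChain ω₂ lam β γ).hamiltonian N y) := fun y =>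
    ((Real.norm_eq_abs _).symm.le.trans (hB y)).trans
      (le_mul_of_one_le_right hB0 (pinnedChain_one_le_exp_mul_hamiltonian hω hl hβ hϑ0.le y))
  exact pinnedChain_integral_sq_act_le hω hl hβ hγ hN hT hϑ0 h2ϑ hg hgb u

omit hβ hγ hN in
/-- A bounded continuous observable is square integrable for `μ_T`. [folklore] -/
theorem pinnedChain_integrable_sq_of_bounded {f : PhaseSpace N → ℝ} (hf : Continuous f) {B : ℝ}
    (hB : ∀ y, ‖f y‖ ≤ B) (hβ' : 0 ≤ β) :
    Integrable (fun y => f y ^ 2) ((pinnedChain ω₂ lam β γ).gibbsMeasure N T) := by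
  haveI : IsProbabilityMeasure ((pinnedChain ω₂ lam β γ).gibbsMeasure N T) :=
    pinnedChain_isProbabilityMeasure_gibbsMeasure hω hl hβ' γ N hT
  refine (integrable_const (B ^ 2)).mono' (hf.pow 2).aestronglyMeasurable (Eventually.of_forall fun y => ?_)
  rw [Real.norm_eq_abs, abs_pow, ← Real.norm_eq_abs]
  exact pow_le_pow_left₀ (norm_nonneg _) (hB y) 2

/-- **Weighted Cauchy–Schwarz for correlations**: for bounded continuous `f, g`, `u ≥ 0` and `ε > 0`,
`|⟨f, P_u g⟩_{μ_T}| ≤ (ε ∫ f² dμ_T + ε⁻¹ ∫ g² dμ_T)/2`. [folklore] -/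
theorem pinnedChain_corr_abs_le_weighted {f g : PhaseSpace N → ℝ} (hf : Continuous f) (hg : Continuous g)
    {Bf Bg : ℝ} (hBf : ∀ y, ‖f y‖ ≤ Bf) (hBg : ∀ y, ‖g y‖ ≤ Bg) (u : ℝ≥0) {ε : ℝ} (hε : 0 < ε) :
    |∫ z, f z * (∫ y, g y ∂((pinnedChain ω₂ lam β γ).transitionKernel N T T u z))
        ∂((pinnedChain ω₂ lam β γ).gibbsMeasure N T)| ≤
      (ε * ∫ z, f z ^ 2 ∂((pinnedChain ω₂ lam β γ).gibbsMeasure N T) +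
        ε⁻¹ * ∫ z, g z ^ 2 ∂((pinnedChain ω₂ lam β γ).gibbsMeasure N T)) / 2 := by
  obtain ⟨-, hP2, hle⟩ := pinnedChain_sq_act_le_of_bounded hω hl hβ hγ hN hT hg hBg u
  have hf2 := pinnedChain_integrable_sq_of_bounded hω hl hT hf hBf hβ.le (γ := γ)
  refine (abs_integral_mul_le_weighted hf2 hP2 hε).trans ?_
  have hεi : 0 ≤ ε⁻¹ := inv_nonneg.2 hε.le
  have := mul_le_mul_of_nonneg_left hle hεi
  linarith

/-! ### Measurability and integrability of the Laplace integrand -/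

omit hβ hγ hN hT in
/-- `t ↦ ⟨f, P_{t⁺} g⟩_{μ_T}` is (strongly) measurable for measurable `f, g` with `f` bounded... in fact for any
measurable `f, g` (it is the parametric integral of a jointly measurable function). [folklore] -/
theorem pinnedChain_stronglyMeasurable_corr (hβ' : 0 ≤ β) (hγ' : 0 ≤ γ) {f g : PhaseSpace N → ℝ}
    (hf : Measurable f) (hg : Measurable g) :
    StronglyMeasurable fun t : ℝ => ∫ z, f z * (∫ y, g y
      ∂((pinnedChain ω₂ lam β γ).transitionKernel N T T t.toNNReal z)) ∂((pinnedChain ω₂ lam β γ).gibbsMeasure N T) := by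
  haveI : SFinite ((pinnedChain ω₂ lam β γ).gibbsMeasure N T) := by
    rw [OscillatorChain.gibbsMeasure_eq]; infer_instance
  have h1 := pinnedChain_stronglyMeasurable_act_uncurry hω hl hβ' hγ' T T (N := N) hg
  have h2 : StronglyMeasurable fun q : ℝ × PhaseSpace N => f q.2 * ∫ y, g y
      ∂((pinnedChain ω₂ lam β γ).transitionKernel N T T q.1.toNNReal q.2) :=
    (hf.comp measurable_snd).stronglyMeasurable.mul h1
  exact h2.integral_prod_right' (ν := (pinnedChain ω₂ lam β γ).gibbsMeasure N T)

omit hN hT in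
/-- **The Laplace integrand is integrable**: for bounded continuous `f, g` and `λ > 0`,
`t ↦ e^{-λt} ⟨f, P_{t⁺} g⟩_{μ_T}` is integrable on `(0,∞)`, and bounded by `e^{-λt} M` whenever `|⟨f,P_u g⟩| ≤ M`
for all `u`. [folklore] -/
theorem pinnedChain_integrableOn_lapIntegrand {f g : PhaseSpace N → ℝ} (hf : Continuous f) (hg : Continuous g)
    {M : ℝ} (hM : ∀ u : ℝ≥0, |∫ z, f z * (∫ y, g y ∂((pinnedChain ω₂ lam β γ).transitionKernel N T T u z))
        ∂((pinnedChain ω₂ lam β γ).gibbsMeasure N T)| ≤ M) {lam' : ℝ} (hlam : 0 < lam') :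
    IntegrableOn (fun t : ℝ => Real.exp (-(lam' * t)) * ∫ z, f z * (∫ y, g y
      ∂((pinnedChain ω₂ lam β γ).transitionKernel N T T t.toNNReal z)) ∂((pinnedChain ω₂ lam β γ).gibbsMeasure N T))
      (Ioi 0) := by
  have hm := pinnedChain_stronglyMeasurable_corr hω hl hβ.le hγ.le (T := T) hf.measurable hg.measurable
  have hexpm : Continuous fun t : ℝ => Real.exp (-(lam' * t)) :=
    Real.continuous_exp.comp (continuous_const.mul continuous_id).neg
  refine Integrable.mono' ((exp_neg_integrableOn_Ioi 0 hlam).const_mul M)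
    (hexpm.aestronglyMeasurable.mul hm.aestronglyMeasurable) ?_
  refine (ae_restrict_iff' measurableSet_Ioi).2 (Eventually.of_forall fun t _ => ?_)
  rw [norm_mul, Real.norm_eq_abs, abs_of_pos (Real.exp_pos _), Real.norm_eq_abs, neg_mul, mul_comm M]
  exact mul_le_mul_of_nonneg_left (hM _) (Real.exp_pos _).le

omit hω hl hβ hγ hN hT in
/-- **The bound on the Laplace-transformed correlation**: with `|⟨f, P_u g⟩| ≤ M` for all `u`,
`|∫₀^∞ e^{-λt} ⟨f, P_t g⟩ dt| ≤ M/λ`. [folklore] -/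
theorem pinnedChain_abs_lap_le {f g : PhaseSpace N → ℝ}
    {M : ℝ} (hM : ∀ u : ℝ≥0, |∫ z, f z * (∫ y, g y ∂((pinnedChain ω₂ lam β γ).transitionKernel N T T u z))
        ∂((pinnedChain ω₂ lam β γ).gibbsMeasure N T)| ≤ M) {lam' : ℝ} (hlam : 0 < lam') :
    |∫ t in Ioi (0 : ℝ), Real.exp (-(lam' * t)) * ∫ z, f z * (∫ y, g y
      ∂((pinnedChain ω₂ lam β γ).transitionKernel N T T t.toNNReal z)) ∂((pinnedChain ω₂ lam β γ).gibbsMeasure N T)|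
      ≤ M / lam' := by
  have hbound : ∀ᵐ t ∂(volume.restrict (Ioi (0 : ℝ))), ‖Real.exp (-(lam' * t)) * ∫ z, f z * (∫ y, g y
      ∂((pinnedChain ω₂ lam β γ).transitionKernel N T T t.toNNReal z)) ∂((pinnedChain ω₂ lam β γ).gibbsMeasure N T)‖
      ≤ M * Real.exp (-(lam' * t)) :=
    (ae_restrict_iff' measurableSet_Ioi).2 (Eventually.of_forall fun t _ => by
      rw [norm_mul, Real.norm_eq_abs, abs_of_pos (Real.exp_pos _), Real.norm_eq_abs, mul_comm M]
      exact mul_le_mul_of_nonneg_left (hM _) (Real.exp_pos _).le)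
  have hI : Integrable (fun t : ℝ => M * Real.exp (-(lam' * t))) (volume.restrict (Ioi 0)) := by
    have := (exp_neg_integrableOn_Ioi 0 hlam).const_mul M
    refine this.congr (Eventually.of_forall fun t => ?_)
    simp [neg_mul]
  have h := norm_integral_le_of_norm_le hI hbound
  rw [Real.norm_eq_abs, integral_const_mul, integral_exp_neg_mul_Ioi hlam] at h
  calc _ ≤ M * (1 / lam') := h
    _ = M / lam' := by ring

/-- **Weighted bound on `B_λ`**: for bounded continuous `f, g`, `λ > 0`, `ε > 0`,
`|B_λ(f,g)| ≤ (ε ∫ f² dμ_T + ε⁻¹ ∫ g² dμ_T)/(2λ)`. [folklore] -/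
theorem pinnedChain_abs_lap_le_weighted {f g : PhaseSpace N → ℝ} (hf : Continuous f) (hg : Continuous g)
    {Bf Bg : ℝ} (hBf : ∀ y, ‖f y‖ ≤ Bf) (hBg : ∀ y, ‖g y‖ ≤ Bg) {lam' : ℝ} (hlam : 0 < lam') {ε : ℝ} (hε : 0 < ε) :
    |∫ t in Ioi (0 : ℝ), Real.exp (-(lam' * t)) * ∫ z, f z * (∫ y, g y
      ∂((pinnedChain ω₂ lam β γ).transitionKernel N T T t.toNNReal z)) ∂((pinnedChain ω₂ lam β γ).gibbsMeasure N T)|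
      ≤ (ε * ∫ z, f z ^ 2 ∂((pinnedChain ω₂ lam β γ).gibbsMeasure N T) +
          ε⁻¹ * ∫ z, g z ^ 2 ∂((pinnedChain ω₂ lam β γ).gibbsMeasure N T)) / 2 / lam' :=
  pinnedChain_abs_lap_le
    (fun u => pinnedChain_corr_abs_le_weighted hω hl hβ hγ hN hT hf hg hBf hBg u hε) hlam

/-! ### Additivity of `B_λ` in each slot -/

omit hN hT in
/-- `P_u (g₁ - g₂) = P_u g₁ - P_u g₂` for bounded continuous `g₁, g₂`. [folklore] -/
theorem pinnedChain_act_sub {g₁ g₂ : PhaseSpace N → ℝ} (hg₁ : Continuous g₁) (hg₂ : Continuous g₂)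
    {B₁ B₂ : ℝ} (hB₁ : ∀ y, ‖g₁ y‖ ≤ B₁) (hB₂ : ∀ y, ‖g₂ y‖ ≤ B₂) (u : ℝ≥0) (z : PhaseSpace N) :
    ∫ y, (g₁ y - g₂ y) ∂((pinnedChain ω₂ lam β γ).transitionKernel N T T u z) =
      (∫ y, g₁ y ∂((pinnedChain ω₂ lam β γ).transitionKernel N T T u z)) -
        ∫ y, g₂ y ∂((pinnedChain ω₂ lam β γ).transitionKernel N T T u z) := by
  haveI := pinnedChain_isMarkovKernel_transitionKernel hω hl hβ.le hγ.le N T T u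
  have i₁ : Integrable g₁ ((pinnedChain ω₂ lam β γ).transitionKernel N T T u z) :=
    (integrable_const B₁).mono' hg₁.aestronglyMeasurable (Eventually.of_forall hB₁)
  have i₂ : Integrable g₂ ((pinnedChain ω₂ lam β γ).transitionKernel N T T u z) :=
    (integrable_const B₂).mono' hg₂.aestronglyMeasurable (Eventually.of_forall hB₂)
  exact integral_sub i₁ i₂

omit hN in
/-- The correlation integrand `z ↦ f(z) P_u g(z)` is integrable for `μ_T` (bounded continuous `f, g`). [folklore] -/
theorem pinnedChain_integrable_corrIntegrand {f g : PhaseSpace N → ℝ} (hf : Continuous f) (hg : Continuous g)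
    {Bf Bg : ℝ} (hBf : ∀ y, ‖f y‖ ≤ Bf) (hBg : ∀ y, ‖g y‖ ≤ Bg) (u : ℝ≥0) :
    Integrable (fun z => f z * ∫ y, g y ∂((pinnedChain ω₂ lam β γ).transitionKernel N T T u z))
      ((pinnedChain ω₂ lam β γ).gibbsMeasure N T) := by
  haveI : IsProbabilityMeasure ((pinnedChain ω₂ lam β γ).gibbsMeasure N T) :=
    pinnedChain_isProbabilityMeasure_gibbsMeasure hω hl hβ.le γ N hT
  have hBf0 : 0 ≤ Bf := (norm_nonneg _).trans (hBf 0)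
  refine (integrable_const (Bf * Bg)).mono'
    (hf.aestronglyMeasurable.mul (hg.stronglyMeasurable.integral_kernel
      (κ := (pinnedChain ω₂ lam β γ).transitionKernel N T T u)).aestronglyMeasurable)
    (Eventually.of_forall fun z => ?_)
  rw [norm_mul]
  exact mul_le_mul (hBf z) (pinnedChain_abs_act_le_of_bounded hω hl hβ hγ hBg u z) (norm_nonneg _) hBf0

/-- **Additivity of `B_λ` in the first slot**: `B_λ(f₁,g) - B_λ(f₂,g) = B_λ(f₁ - f₂, g)`. [folklore] -/
theorem pinnedChain_lap_sub_left {f₁ f₂ g : PhaseSpace N → ℝ} (hf₁ : Continuous f₁) (hf₂ : Continuous f₂)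
    (hg : Continuous g) {B₁ B₂ Bg : ℝ} (hB₁ : ∀ y, ‖f₁ y‖ ≤ B₁) (hB₂ : ∀ y, ‖f₂ y‖ ≤ B₂) (hBg : ∀ y, ‖g y‖ ≤ Bg)
    {lam' : ℝ} (hlam : 0 < lam') :
    (∫ t in Ioi (0 : ℝ), Real.exp (-(lam' * t)) * ∫ z, f₁ z * (∫ y, g y
      ∂((pinnedChain ω₂ lam β γ).transitionKernel N T T t.toNNReal z)) ∂((pinnedChain ω₂ lam β γ).gibbsMeasure N T)) -
    (∫ t in Ioi (0 : ℝ), Real.exp (-(lam' * t)) * ∫ z, f₂ z * (∫ y, g y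
      ∂((pinnedChain ω₂ lam β γ).transitionKernel N T T t.toNNReal z)) ∂((pinnedChain ω₂ lam β γ).gibbsMeasure N T)) =
    ∫ t in Ioi (0 : ℝ), Real.exp (-(lam' * t)) * ∫ z, (f₁ z - f₂ z) * (∫ y, g y
      ∂((pinnedChain ω₂ lam β γ).transitionKernel N T T t.toNNReal z)) ∂((pinnedChain ω₂ lam β γ).gibbsMeasure N T) := by
  have I₁ := pinnedChain_integrableOn_lapIntegrand hω hl hβ hγ hf₁ hg
    (fun u => pinnedChain_corr_abs_le_weighted hω hl hβ hγ hN hT hf₁ hg hB₁ hBg u one_pos) hlam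
  have I₂ := pinnedChain_integrableOn_lapIntegrand hω hl hβ hγ hf₂ hg
    (fun u => pinnedChain_corr_abs_le_weighted hω hl hβ hγ hN hT hf₂ hg hB₂ hBg u one_pos) hlam
  rw [← integral_sub I₁ I₂]
  refine integral_congr_ae ((ae_restrict_iff' measurableSet_Ioi).2 (Eventually.of_forall fun t _ => ?_))
  beta_reduce
  rw [← mul_sub, ← integral_sub (pinnedChain_integrable_corrIntegrand hω hl hβ hγ hT hf₁ hg hB₁ hBg _)
    (pinnedChain_integrable_corrIntegrand hω hl hβ hγ hT hf₂ hg hB₂ hBg _)]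
  congr 1
  refine integral_congr_ae (Eventually.of_forall fun z => ?_)
  beta_reduce
  ring

/-- **Additivity of `B_λ` in the second slot**: `B_λ(f,g₁) - B_λ(f,g₂) = B_λ(f, g₁ - g₂)`. [folklore] -/
theorem pinnedChain_lap_sub_right {f g₁ g₂ : PhaseSpace N → ℝ} (hf : Continuous f) (hg₁ : Continuous g₁)
    (hg₂ : Continuous g₂) {Bf B₁ B₂ : ℝ} (hBf : ∀ y, ‖f y‖ ≤ Bf) (hB₁ : ∀ y, ‖g₁ y‖ ≤ B₁) (hB₂ : ∀ y, ‖g₂ y‖ ≤ B₂)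
    {lam' : ℝ} (hlam : 0 < lam') :
    (∫ t in Ioi (0 : ℝ), Real.exp (-(lam' * t)) * ∫ z, f z * (∫ y, g₁ y
      ∂((pinnedChain ω₂ lam β γ).transitionKernel N T T t.toNNReal z)) ∂((pinnedChain ω₂ lam β γ).gibbsMeasure N T)) -
    (∫ t in Ioi (0 : ℝ), Real.exp (-(lam' * t)) * ∫ z, f z * (∫ y, g₂ y
      ∂((pinnedChain ω₂ lam β γ).transitionKernel N T T t.toNNReal z)) ∂((pinnedChain ω₂ lam β γ).gibbsMeasure N T)) =
    ∫ t in Ioi (0 : ℝ), Real.exp (-(lam' * t)) * ∫ z, f z * (∫ y, (g₁ y - g₂ y)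
      ∂((pinnedChain ω₂ lam β γ).transitionKernel N T T t.toNNReal z)) ∂((pinnedChain ω₂ lam β γ).gibbsMeasure N T) := by
  have I₁ := pinnedChain_integrableOn_lapIntegrand hω hl hβ hγ hf hg₁
    (fun u => pinnedChain_corr_abs_le_weighted hω hl hβ hγ hN hT hf hg₁ hBf hB₁ u one_pos) hlam
  have I₂ := pinnedChain_integrableOn_lapIntegrand hω hl hβ hγ hf hg₂
    (fun u => pinnedChain_corr_abs_le_weighted hω hl hβ hγ hN hT hf hg₂ hBf hB₂ u one_pos) hlam
  rw [← integral_sub I₁ I₂]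
  refine integral_congr_ae ((ae_restrict_iff' measurableSet_Ioi).2 (Eventually.of_forall fun t _ => ?_))
  beta_reduce
  rw [← mul_sub, ← integral_sub (pinnedChain_integrable_corrIntegrand hω hl hβ hγ hT hf hg₁ hBf hB₁ _)
    (pinnedChain_integrable_corrIntegrand hω hl hβ hγ hT hf hg₂ hBf hB₂ _)]
  congr 1
  refine integral_congr_ae (Eventually.of_forall fun z => ?_)
  beta_reduce
  rw [pinnedChain_act_sub hω hl hβ hγ hg₁ hg₂ hB₁ hB₂]
  ring

end Pinned

/-- Registered anchor `helper_laplaceWeightedBound` of this file (= `pinnedChain_abs_lap_le_weighted` in closed form): the weighted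
`L²(μ_T)` bound on the Laplace-transformed correlation. [folklore] -/
theorem helper_laplaceWeightedBound : ∀ ω₂ lam β γ : ℝ, 0 < ω₂ → 0 ≤ lam → 0 < β → 0 < γ → ∀ (N : ℕ), 0 < N → ∀ T : ℝ, 0 < T → ∀ (f g : PhaseSpace N → ℝ), Continuous f → Continuous g → ∀ (Bf Bg : ℝ), (∀ y, ‖f y‖ ≤ Bf) → (∀ y, ‖g y‖ ≤ Bg) → ∀ lam' : ℝ, 0 < lam' → ∀ ε : ℝ, 0 < ε → |∫ t in Set.Ioi (0 : ℝ), Real.exp (-(lam' * t)) * ∫ z, f z * (∫ y, g y ∂((pinnedChain ω₂ lam β γ).transitionKernel N T T t.toNNReal z)) ∂((pinnedChain ω₂ lam β γ).gibbsMeasure N T)| ≤ (ε * ∫ z, f z ^ 2 ∂((pinnedChain ω₂ lam β γ).gibbsMeasure N T) + ε⁻¹ * ∫ z, g z ^ 2 ∂((pinnedChain ω₂ lam β γ).gibbsMeasure N T)) / 2 / lam' :=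
  fun _ _ _ _ hω hl hβ hγ _ hN _ hT _ _ hf hg _ _ hBf hBg _ hlam _ hε =>
    pinnedChain_abs_lap_le_weighted hω hl hβ hγ hN hT hf hg hBf hBg hlam hε

end Summit.AtomisticToContinuum.FouriersLaw.Theorems.SubdiffusiveBondHeat
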